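import Mathlib.NumberTheory.NumberField.CanonicalEmbedding.Basic
import Mathlib.Data.Set.Card
import Literature.NumberTheory.Automorphic.SmallRationalAdeles
import Literature.NumberTheory.Automorphic.AdelicAdditiveCharacter
import Literature.NumberTheory.Automorphic.RationalPointsConeConjugates
import Literature.MathematicalPhysics.StatisticalMechanics.LennardJonesClusters
import HarnessLib

/-!
# Counting rational points in real dilates of adelic boxes, and rational matrices in
`a C a⁻¹` for positive real diagonal `a`
(Borel, *Automorphic forms on `SL₂(ℝ)`* (1997), Prop. 5.7 and its proof — the moderate growth
`|(f * φ)(x)| ≤ c_φ ‖f‖_p a(x)^{2ρ/p}` on a Siegel set, through the size of `x C` modulo `Γ` —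
PDF pp. 50–51 of the held copy; Cassels–Fröhlich, Ch. II §14 (`K` discrete in `𝔸_K`);
Moeglin–Waldspurger, *Spectral Decomposition and Eisenstein Series* (1995), §I.2 (the kernel of
`R(f)` on a Siegel set is bounded by a power of the height))

A brick of the basic estimate for cusp forms on a Siegel set of `GL_n`
(`GLnCuspidalSpectrum.norm_smoothedForm_le_of_isSiegelSetGL` of `GLnCuspidalSpectrumSiegel`,
Garrett (2018) Thm. 7.3.10 / Getz–Hahn (2024) Prop. 9.6.1) by the route "moderate growth of the
kernel + derivatives along the unipotent radical": the *moderate growth* half needs a bound for the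
number of rational matrices `γ ∈ GL_n(K)` in a conjugate `a C a⁻¹` of a fixed compact
`C ⊆ GL_n(𝔸_K)` by a positive real diagonal matrix `a = diag(a₁, …, aₙ)` (`posRealDiagonal` of
`ReductionTheoryGLn`), polynomial in the ratios `aᵢ/aⱼ`. Everything here is proved:

* `ncard_inter_closedBall_le_of_le_dist` — **packing**: a subset of a finite-dimensional real
  normed space whose points are `ε`-separated meets the ball of radius `R` in a finite set of at
  most `(2R/ε + 1)^{dim}` points (the tree's `card_le_of_separated_of_dist_le`, volume argument of
  Mathlib's `Besicovitch.card_le_of_separated`).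
* `Submodule.exists_pos_forall_le_norm_of_discrete` — a discrete `ℤ`-submodule is uniformly
  separated from `0`.
* `NumberField.ncard_integers_mixedEmbedding_mem_smul_le` — **lattice points of `𝓞 K` in real
  dilates of a bounded set** of `K ⊗ ℝ = ℝ^{r₁} × ℂ^{r₂}` (`mixedSpace`): `#{x ∈ 𝓞 K : ι(x) ∈ r B}
  ≤ C_B · max(1, r)^{[K:ℚ]}` for all `r > 0` (Mathlib's discrete `integerLattice`, and
  `finrank ℝ (mixedSpace K) = [K:ℚ]`).
* `ncard_algebraMap_mem_realAdele_smul_le` — **rational points in real dilates of a compact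
  adelic box**: for compact `B ⊆ 𝔸_K`, `#{k ∈ K : k ∈ (r, 1) · B} ≤ C_B · max(1, r)^{[K:ℚ]}`
  for all `r > 0`, where `(r, 1) = realAdele K r` is the real scalar `r` at the archimedean
  places (`ReductionTheoryGLnConjugation`): clear the denominators of the finite part by one
  `d ∈ 𝓞 K ∖ 0` (`FiniteAdeleRing.exists_ne_zero_forall_mem_mul_mem` of `SmallRationalAdeles`), so
  that `d k ∈ 𝓞 K` (`isFiniteIntegral_algebraMap_iff` of `AdelicAdditiveCharacter`) with
  `ι(d k) ∈ r · ι(d) B_∞`.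
* `ncard_rationalPointsGL_conj_posRealDiagonal_le` — **rational matrices in `a C a⁻¹`**: for
  compact `C ⊆ GL_n(𝔸_K)` there is `C₀` with
  `#{γ ∈ GL_n(K) : a⁻¹ γ a ∈ C} ≤ C₀ · ∏_{i,j} max(1, aᵢ/aⱼ)^{[K:ℚ]}` for every positive real
  diagonal `a` (the `(i, j)` entry of `γ = a c a⁻¹` is `(aᵢ/aⱼ, 1) · c_{ij}`,
  `coe_posRealDiagonal_mul_mul_inv_apply` of `RationalPointsConeConjugates`), and on the Siegel cone
  (`t · a_{i+1} ≤ aᵢ`) the right-hand side is at most `C_t · ∏_{i<j} (aᵢ/aⱼ)^{[K:ℚ]}`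
  (`prod_max_one_div_le_mul_prod_root`; its `[K:ℚ]`-th power is the value at `a` of the modular
  function of the Borel subgroup).

This is a counting version of the moderate growth of the automorphic kernel on Siegel sets
(Borel (1997), Prop. 5.7, proves the `SL₂(ℝ)` case through the dilation `ℓ(a D a⁻¹) ≤ a^{2ρ} ℓ(D)`
of Haar measure on `N`; Moeglin–Waldspurger §I.2); no Haar measure enters here.

## References

* A. Borel, *Automorphic forms on `SL₂(ℝ)`*, Cambridge Tracts in Math. 130 (1997), Prop. 5.7
  (PDF pp. 50–51 of `book:borelnd-automorphic-forms-sl2-r`) [Borel1997].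
* A. Borel, *Introduction aux groupes arithmétiques*, Hermann (1969), §1, §8 [Borel1969].
* C. Moeglin, J.-L. Waldspurger, *Spectral Decomposition and Eisenstein Series*, Cambridge Tracts
  113 (1995), §I.2 [MoeglinWaldspurger1995].
* J. W. S. Cassels, A. Fröhlich (eds.), *Algebraic Number Theory* (1967), Ch. II §14 (`K` discrete
  and cocompact in `𝔸_K`) [CasselsFrohlichANT1967].
-/

noncomputable section

open scoped NNReal MatrixGroups Pointwise Classical
open NumberField NumberField.mixedEmbedding IsDedekindDomain Set Metric Module
open _root_.Topology

namespace Literature.NumberTheory.Automorphic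

/-! ### Packing: separated sets meet balls in few points -/

section Packing

variable {E : Type*} [NormedAddCommGroup E] [NormedSpace ℝ E] [FiniteDimensional ℝ E]

/-- **Packing bound.** If the points of `Λ ⊆ E` are pairwise at distance `≥ ε > 0`, then
`Λ ∩ B̄(0, R)` is finite with at most `(2R/ε + 1)^{dim E}` elements (disjoint balls of radius
`ε/2` inside `B(0, R + ε/2)`; the tree's `card_le_of_separated_of_dist_le`). [folklore] -/
theorem ncard_inter_closedBall_le_of_le_dist {Λ : Set E} {ε : ℝ} (hε : 0 < ε)
    (hsep : ∀ x ∈ Λ, ∀ y ∈ Λ, x ≠ y → ε ≤ dist x y) {R : ℝ} (hR : 0 ≤ R) :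
    (Λ ∩ closedBall 0 R).Finite ∧
      ((Λ ∩ closedBall 0 R).ncard : ℝ) ≤ (2 * R / ε + 1) ^ finrank ℝ E := by
  -- every finite subset obeys the bound
  have hfin : ∀ s : Finset E, (s : Set E) ⊆ Λ ∩ closedBall 0 R →
      (s.card : ℝ) ≤ (2 * R / ε + 1) ^ finrank ℝ E := by
    intro s hs
    refine Literature.MathematicalPhysics.StatisticalMechanics.card_le_of_separated_of_dist_le
      s 0 hε hR (fun c hc => ?_) (fun c hc d hd hcd => ?_)
    · exact mem_closedBall.1 (hs hc).2
    · exact hsep c (hs hc).1 d (hs hd).1 hcd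
  have hF : (Λ ∩ closedBall 0 R).Finite := by
    by_contra hinf
    obtain ⟨s, hs, hcard⟩ := Set.Infinite.exists_subset_card_eq hinf
      (⌊(2 * R / ε + 1) ^ finrank ℝ E⌋₊ + 1)
    have h1 := hfin s hs
    rw [hcard] at h1
    have h2 := Nat.lt_floor_add_one ((2 * R / ε + 1) ^ finrank ℝ E)
    push_cast at h1
    linarith
  refine ⟨hF, ?_⟩
  have h := hfin hF.toFinset (by simp)
  rwa [← Set.ncard_eq_toFinset_card _ hF] at h

/-- A discrete `ℤ`-submodule of a normed group is uniformly separated from `0`: there is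
`ε > 0` with `‖x‖ ≥ ε` for every non-zero `x ∈ L` (the singleton `{0}` is open in `L`).
[folklore] -/
theorem Submodule.exists_pos_forall_le_norm_of_discrete {E : Type*} [NormedAddCommGroup E]
    (L : Submodule ℤ E) [DiscreteTopology L] :
    ∃ ε : ℝ, 0 < ε ∧ ∀ x ∈ L, x ≠ 0 → ε ≤ ‖x‖ := by
  have h : IsOpen ({(0 : L)} : Set L) := isOpen_discrete _
  obtain ⟨ε, hε, hball⟩ := Metric.isOpen_singleton_iff.1 h
  refine ⟨ε, hε, fun x hx hx0 => ?_⟩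
  by_contra hlt
  have h1 : dist (⟨x, hx⟩ : L) 0 < ε := by
    rw [Subtype.dist_eq]
    simpa [dist_zero_right] using not_le.1 hlt
  have h2 := hball ⟨x, hx⟩ h1
  exact hx0 (by simpa using congrArg Subtype.val h2)

/-- Pairwise form: the points of a discrete `ℤ`-submodule are `ε`-separated. [folklore] -/
theorem Submodule.exists_pos_forall_le_dist_of_discrete {E : Type*} [NormedAddCommGroup E]
    (L : Submodule ℤ E) [DiscreteTopology L] :
    ∃ ε : ℝ, 0 < ε ∧ ∀ x ∈ L, ∀ y ∈ L, x ≠ y → ε ≤ dist x y := by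
  obtain ⟨ε, hε, h⟩ := Submodule.exists_pos_forall_le_norm_of_discrete L
  refine ⟨ε, hε, fun x hx y hy hxy => ?_⟩
  rw [dist_eq_norm]
  exact h (x - y) (L.sub_mem hx hy) (sub_ne_zero.2 hxy)

end Packing

/-! ### Lattice points of `𝓞 K` in real dilates of a bounded subset of `K ⊗ ℝ` -/

section NumberField

variable (K : Type) [Field K] [NumberField K]

/-- **Integers of `K` in real dilates of a bounded set.** For a bounded `B ⊆ ℝ^{r₁} × ℂ^{r₂}`
there is `C > 0` such that for every `r > 0` the algebraic integers `x` with `ι(x) ∈ r · B`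
(`ι = mixedEmbedding K`) are finite in number, at most `C · max(1, r)^{[K:ℚ]}` (the image
`ι(𝓞 K)` is the discrete `integerLattice`, `r · B ⊆ B̄(0, r R₀)`, and
`finrank ℝ (mixedSpace K) = [K:ℚ]`). Borel (1969), §1; Cassels–Fröhlich, Ch. II §14.
[cite: CasselsFrohlichANT1967, Ch. II §14] -/
theorem NumberField.ncard_integers_mixedEmbedding_mem_smul_le {B : Set (mixedSpace K)}
    (hB : Bornology.IsBounded B) :
    ∃ C : ℝ, 0 < C ∧ ∀ r : ℝ, 0 < r →
      {x : 𝓞 K | mixedEmbedding K (x : K) ∈ r • B}.Finite ∧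
        (({x : 𝓞 K | mixedEmbedding K (x : K) ∈ r • B}.ncard : ℕ) : ℝ) ≤
          C * max 1 r ^ finrank ℚ K := by
  obtain ⟨R₀, hR₀, hBR⟩ := hB.subset_closedBall_lt 0 (0 : mixedSpace K)
  obtain ⟨ε, hε, hsep⟩ :=
    Submodule.exists_pos_forall_le_dist_of_discrete (mixedEmbedding.integerLattice K)
  refine ⟨(2 * R₀ / ε + 1) ^ finrank ℚ K, by positivity, fun r hr => ?_⟩
  set Λ : Set (mixedSpace K) := (mixedEmbedding.integerLattice K : Set (mixedSpace K)) with hΛ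
  have hpack := ncard_inter_closedBall_le_of_le_dist (Λ := Λ) hε hsep (R := r * R₀)
    (by positivity)
  -- `x ↦ ι(x)` maps our set injectively into `Λ ∩ B̄(0, r R₀)`
  set S : Set (𝓞 K) := {x : 𝓞 K | mixedEmbedding K (x : K) ∈ r • B} with hS
  have hmaps : ∀ x ∈ S, mixedEmbedding K (x : K) ∈ Λ ∩ closedBall 0 (r * R₀) := by
    intro x hx
    refine ⟨⟨x, rfl⟩, ?_⟩
    obtain ⟨b, hb, hbx⟩ := Set.mem_smul_set.1 hx
    rw [mem_closedBall, dist_zero_right, ← hbx, _root_.norm_smul, Real.norm_eq_abs, abs_of_pos hr]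
    have := hBR hb
    rw [mem_closedBall, dist_zero_right] at this
    exact mul_le_mul_of_nonneg_left this hr.le
  have hinj : Set.InjOn (fun x : 𝓞 K => mixedEmbedding K (x : K)) S := by
    intro x _ y _ hxy
    exact Subtype.ext ((mixedEmbedding_injective K) hxy)
  have hle : S.ncard ≤ (Λ ∩ closedBall 0 (r * R₀)).ncard :=
    Set.ncard_le_ncard_of_injOn _ hmaps hinj hpack.1
  have hSfin : S.Finite :=
    Set.Finite.of_finite_image (hpack.1.subset (Set.image_subset_iff.2 hmaps)) hinj
  refine ⟨hSfin, ?_⟩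
  have hD : finrank ℝ (mixedSpace K) = finrank ℚ K := mixedEmbedding.finrank K
  calc ((S.ncard : ℕ) : ℝ) ≤ (Λ ∩ closedBall 0 (r * R₀)).ncard := by exact_mod_cast hle
    _ ≤ (2 * (r * R₀) / ε + 1) ^ finrank ℝ (mixedSpace K) := hpack.2
    _ ≤ ((2 * R₀ / ε + 1) * max 1 r) ^ finrank ℝ (mixedSpace K) := by
        refine pow_le_pow_left₀ (by positivity) ?_ _
        have h1 : (1 : ℝ) ≤ max 1 r := le_max_left _ _
        have h2 : r ≤ max 1 r := le_max_right _ _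
        have h3 : 0 ≤ 2 * R₀ / ε := by positivity
        calc 2 * (r * R₀) / ε + 1 = 2 * R₀ / ε * r + 1 := by ring
          _ ≤ 2 * R₀ / ε * max 1 r + max 1 r := add_le_add (mul_le_mul_of_nonneg_left h2 h3) h1
          _ = (2 * R₀ / ε + 1) * max 1 r := by ring
    _ = (2 * R₀ / ε + 1) ^ finrank ℚ K * max 1 r ^ finrank ℚ K := by rw [mul_pow, hD]

end NumberField

/-! ### Rational points in real dilates of a compact adelic box -/

section Adelic

variable (K : Type) [Field K] [NumberField K]

/-- `realAdele K` is multiplicative: `(x y, 1) = (x, 1) (y, 1)`. [folklore] -/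
theorem realAdele_mul (x y : ℝ) : realAdele K (x * y) = realAdele K x * realAdele K y := by
  refine Prod.ext (map_mul (realToInfiniteAdele K) x y) ?_
  change (realAdele K (x * y)).2 = (realAdele K x).2 * (realAdele K y).2
  rw [realAdele_snd, realAdele_snd, realAdele_snd, one_mul]

/-- **Rational points in real dilates of a compact adelic box.** For compact `B ⊆ 𝔸_K` there is
`C > 0` such that for every `r > 0` the field elements `k ∈ K` whose adele lies in `(r, 1) · B`
(`realAdele K r`: the real scalar `r` at the archimedean places, `1` at the finite ones) are
finite in number, at most `C · max(1, r)^{[K:ℚ]}`. Proof: one `d ∈ 𝓞 K ∖ 0` makes the finite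
parts of `B` integral (`FiniteAdeleRing.exists_ne_zero_forall_mem_mul_mem`), so `d k ∈ 𝓞 K`
(`isFiniteIntegral_algebraMap_iff`) and `ι(d k) ∈ r · ι(d) B_∞`, a dilate of a bounded set; apply
`NumberField.ncard_integers_mixedEmbedding_mem_smul_le`. This is the quantitative form of the
discreteness of `K` in `𝔸_K` (Cassels–Fröhlich, Ch. II §14).
[cite: CasselsFrohlichANT1967, Ch. II §14] -/
theorem ncard_algebraMap_mem_realAdele_smul_le {B : Set (AdeleRing (𝓞 K) K)}
    (hB : IsCompact B) :
    ∃ C : ℝ, 0 < C ∧ ∀ r : ℝ, 0 < r →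
      {k : K | algebraMap K (AdeleRing (𝓞 K) K) k ∈ realAdele K r • B}.Finite ∧
        (({k : K | algebraMap K (AdeleRing (𝓞 K) K) k ∈ realAdele K r • B}.ncard : ℕ) : ℝ) ≤
          C * max 1 r ^ finrank ℚ K := by
  -- clear denominators of the finite parts
  have hBf : IsCompact (Prod.snd '' B) := hB.image continuous_snd
  obtain ⟨d, hd0, hd⟩ := FiniteAdeleRing.exists_ne_zero_forall_mem_mul_mem K hBf
  -- the archimedean parts, in the mixed space, multiplied by `ι(d)`
  set B' : Set (mixedSpace K) :=
    (fun y => mixedEmbedding K (d : K) * y) ''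
      (InfiniteAdeleRing.ringEquiv_mixedSpace K '' (Prod.fst '' B)) with hB'
  have hB'c : IsCompact B' :=
    (((hB.image continuous_fst).image (continuous_ringEquiv_mixedSpace K)).image
      (continuous_const.mul continuous_id))
  have hB'b : Bornology.IsBounded B' := hB'c.isBounded
  obtain ⟨C, hC, hcount⟩ :=
    NumberField.ncard_integers_mixedEmbedding_mem_smul_le K hB'b
  refine ⟨C, hC, fun r hr => ?_⟩
  set S : Set K := {k : K | algebraMap K (AdeleRing (𝓞 K) K) k ∈ realAdele K r • B} with hS
  set T : Set (𝓞 K) := {x : 𝓞 K | mixedEmbedding K (x : K) ∈ r • B'} with hT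
  obtain ⟨hTfin, hTle⟩ := hcount r hr
  -- `k ↦ d k` lands in `𝓞 K`, inside `T`
  have hint : ∀ k ∈ S, ∃ x : 𝓞 K, (x : K) = d * k := by
    intro k hk
    obtain ⟨b, hb, hbk⟩ := Set.mem_smul_set.1 hk
    rw [← isFiniteIntegral_algebraMap_iff]
    intro v
    rw [map_mul, ← hbk, smul_eq_mul]
    change ((algebraMap K (AdeleRing (𝓞 K) K) (d : K)).2 * ((realAdele K r).2 * b.2)) v ∈ _
    rw [realAdele_snd, one_mul, AdeleRing.algebraMap_snd]
    have e : algebraMap K (FiniteAdeleRing (𝓞 K) K) (d : K) =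
        algebraMap (𝓞 K) (FiniteAdeleRing (𝓞 K) K) d := by
      rw [← IsScalarTower.algebraMap_apply]
    rw [e]
    exact hd b.2 ⟨b, hb, rfl⟩ v
  choose! f hf using hint
  have hmaps : ∀ k ∈ S, f k ∈ T := by
    intro k hk
    obtain ⟨b, hb, hbk⟩ := Set.mem_smul_set.1 hk
    change mixedEmbedding K ((f k : 𝓞 K) : K) ∈ r • B'
    rw [hf k hk, map_mul, InfiniteAdeleRing.mixedEmbedding_eq_algebraMap_comp (x := k),
      ← AdeleRing.algebraMap_fst, ← hbk, smul_eq_mul]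
    change mixedEmbedding K (d : K) *
        InfiniteAdeleRing.ringEquiv_mixedSpace K ((realAdele K r).1 * b.1) ∈ r • B'
    rw [realAdele_fst, map_mul, ringEquiv_mixedSpace_realToInfiniteAdele, ← Algebra.smul_def,
      mul_smul_comm]
    exact Set.smul_mem_smul_set ⟨_, ⟨b.1, ⟨b, hb, rfl⟩, rfl⟩, rfl⟩
  have hinj : Set.InjOn f S := by
    intro k hk k' hk' hkk'
    have h1 := hf k hk
    have h2 := hf k' hk'
    rw [hkk'] at h1
    have hd0' : ((d : 𝓞 K) : K) ≠ 0 := by exact_mod_cast hd0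
    exact mul_left_cancel₀ hd0' (h1.symm.trans h2)
  have hle : S.ncard ≤ T.ncard := Set.ncard_le_ncard_of_injOn f hmaps hinj hTfin
  have hSfin : S.Finite :=
    Set.Finite.of_finite_image (hTfin.subset (Set.image_subset_iff.2 hmaps)) hinj
  exact ⟨hSfin, (Nat.cast_le.2 hle).trans hTle⟩

end Adelic

/-! ### Rational matrices in `a C a⁻¹` -/

section Matrices

variable {n : ℕ} {K : Type} [Field K] [NumberField K]

variable (n K) in
/-- **Rational matrices in `a C a⁻¹`.** For compact `C ⊆ GL_n(𝔸_K)` there is `C₀ > 0` such that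
for every positive real diagonal `a = diag(a₁, …, aₙ)` (`posRealDiagonal`) the rational matrices
`γ ∈ GL_n(K)` (`rationalPointsGL`) with `a⁻¹ γ a ∈ C` are finite in number, at most
`C₀ · ∏_{i,j} max(1, aᵢ/aⱼ)^{[K:ℚ]}`: the `(i, j)` entry of `γ = a c a⁻¹` is the rational adele
`(aᵢ/aⱼ, 1) c_{ij}` with `c_{ij}` in the compact set of `(i, j)` entries of `C`, and there are at
most `C_{ij} max(1, aᵢ/aⱼ)^{[K:ℚ]}` such (`ncard_algebraMap_mem_realAdele_smul_le`). This is the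
count behind the moderate growth of the kernel `Σ_γ f(x⁻¹ γ y)` on Siegel sets (Borel (1997),
proof of Prop. 5.7, PDF pp. 50–51, in the `SL₂(ℝ)` case; Moeglin–Waldspurger (1995), §I.2).
[cite: Borel1997, Prop. 5.7 (PDF pp. 50–51)] -/
theorem ncard_rationalPointsGL_conj_posRealDiagonal_le {C : Set (GL (Fin n) (AdeleRing (𝓞 K) K))}
    (hC : IsCompact C) :
    ∃ C₀ : ℝ, 0 < C₀ ∧ ∀ a : Fin n → ℝ≥0ˣ,
      {γ : GL (Fin n) (AdeleRing (𝓞 K) K) | γ ∈ rationalPointsGL n K ∧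
          (posRealDiagonal n K a)⁻¹ * γ * posRealDiagonal n K a ∈ C}.Finite ∧
      (({γ : GL (Fin n) (AdeleRing (𝓞 K) K) | γ ∈ rationalPointsGL n K ∧
          (posRealDiagonal n K a)⁻¹ * γ * posRealDiagonal n K a ∈ C}.ncard : ℕ) : ℝ) ≤
        C₀ * ∏ i : Fin n, ∏ j : Fin n,
          max 1 (((a i : ℝ≥0) : ℝ) / ((a j : ℝ≥0) : ℝ)) ^ finrank ℚ K := by
  -- the compact sets of entries
  set E : Fin n → Fin n → Set (AdeleRing (𝓞 K) K) := fun i j =>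
    (fun c : GL (Fin n) (AdeleRing (𝓞 K) K) =>
      (c : Matrix (Fin n) (Fin n) (AdeleRing (𝓞 K) K)) i j) '' C with hE
  have hEc : ∀ i j, IsCompact (E i j) := fun i j =>
    hC.image (Units.continuous_val.matrix_elem i j)
  choose Cij hCij hcnt using fun i j => ncard_algebraMap_mem_realAdele_smul_le K (hEc i j)
  refine ⟨∏ i, ∏ j, Cij i j, Finset.prod_pos fun i _ => Finset.prod_pos fun j _ => hCij i j,
    fun a => ?_⟩
  set r : Fin n → Fin n → ℝ := fun i j => ((a i : ℝ≥0) : ℝ) / ((a j : ℝ≥0) : ℝ) with hr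
  have hrpos : ∀ i j, 0 < r i j := fun i j =>
    div_pos (NNReal.coe_pos.2 (pos_iff_ne_zero.2 (a i).ne_zero))
      (NNReal.coe_pos.2 (pos_iff_ne_zero.2 (a j).ne_zero))
  -- the finite sets of admissible rational entries
  set T : Fin n → Fin n → Set K := fun i j =>
    {k : K | algebraMap K (AdeleRing (𝓞 K) K) k ∈ realAdele K (r i j) • E i j} with hT
  have hTfin : ∀ i j, (T i j).Finite := fun i j => (hcnt i j (r i j) (hrpos i j)).1
  have hTle : ∀ i j, (((T i j).ncard : ℕ) : ℝ) ≤ Cij i j * max 1 (r i j) ^ finrank ℚ K :=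
    fun i j => (hcnt i j (r i j) (hrpos i j)).2
  set S : Set (GL (Fin n) (AdeleRing (𝓞 K) K)) :=
    {γ | γ ∈ rationalPointsGL n K ∧ (posRealDiagonal n K a)⁻¹ * γ * posRealDiagonal n K a ∈ C}
    with hS
  -- the set of entry functions, a product of the `T i j`
  set P : Set (Fin n → Fin n → K) := {k | ∀ i, k i ∈ Set.pi Set.univ (T i)} with hP
  have hPfin : P.Finite := Set.Finite.pi' fun i => Set.Finite.pi fun j => hTfin i j
  have hPcard : P.ncard = ∏ i, ∏ j, (T i j).ncard := by
    have h1 : P = Set.pi Set.univ fun i => Set.pi Set.univ (T i) := by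
      ext k; simp [hP]
    have h2 : P.encard = ∏ i, ∏ j, ((T i j).ncard : ℕ∞) := by
      rw [h1, Set.encard_pi_eq_prod_encard]
      refine Finset.prod_congr rfl fun i _ => ?_
      rw [Set.encard_pi_eq_prod_encard]
      refine Finset.prod_congr rfl fun j _ => ?_
      rw [(hTfin i j).cast_ncard_eq]
    have h3 : (P.ncard : ℕ∞) = ((∏ i, ∏ j, (T i j).ncard : ℕ) : ℕ∞) := by
      rw [hPfin.cast_ncard_eq, h2]
      push_cast
      rfl
    exact_mod_cast h3
  -- `γ ↦` its matrix of rational entries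
  have hrat : ∀ γ ∈ S, ∃ k : Fin n → Fin n → K, ∀ i j,
      (γ : Matrix (Fin n) (Fin n) (AdeleRing (𝓞 K) K)) i j =
        algebraMap K (AdeleRing (𝓞 K) K) (k i j) := by
    rintro γ ⟨⟨g, rfl⟩, -⟩
    exact ⟨fun i j => (g : Matrix (Fin n) (Fin n) K) i j, fun i j => rfl⟩
  choose! k hk using hrat
  have hmaps : ∀ γ ∈ S, k γ ∈ P := by
    intro γ hγ i j _
    change algebraMap K (AdeleRing (𝓞 K) K) (k γ i j) ∈ realAdele K (r i j) • E i j
    rw [← hk γ hγ i j]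
    set c := (posRealDiagonal n K a)⁻¹ * γ * posRealDiagonal n K a with hc
    have hγ' : γ = posRealDiagonal n K a * c * (posRealDiagonal n K a)⁻¹ := by
      rw [hc]; group
    refine Set.mem_smul_set.2 ⟨(c : Matrix (Fin n) (Fin n) (AdeleRing (𝓞 K) K)) i j,
      ⟨c, hγ.2, rfl⟩, ?_⟩
    rw [smul_eq_mul, hγ', coe_posRealDiagonal_mul_mul_inv_apply]
  have hinj : Set.InjOn k S := by
    intro γ hγ γ' hγ' hkk
    refine Units.ext (Matrix.ext fun i j => ?_)
    rw [hk γ hγ i j, hk γ' hγ' i j, hkk]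
  have hle : S.ncard ≤ P.ncard := Set.ncard_le_ncard_of_injOn k hmaps hinj hPfin
  have hSfin : S.Finite :=
    Set.Finite.of_finite_image (hPfin.subset (Set.image_subset_iff.2 hmaps)) hinj
  refine ⟨hSfin, ?_⟩
  calc ((S.ncard : ℕ) : ℝ) ≤ P.ncard := by exact_mod_cast hle
    _ = ∏ i, ∏ j, (((T i j).ncard : ℕ) : ℝ) := by rw [hPcard]; push_cast; rfl
    _ ≤ ∏ i, ∏ j, Cij i j * max 1 (r i j) ^ finrank ℚ K := by
        refine Finset.prod_le_prod (fun i _ => Finset.prod_nonneg fun j _ => by positivity)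
          fun i _ => Finset.prod_le_prod (fun j _ => by positivity) fun j _ => hTle i j
    _ = (∏ i, ∏ j, Cij i j) * ∏ i, ∏ j, max 1 (r i j) ^ finrank ℚ K := by
        rw [← Finset.prod_mul_distrib]
        refine Finset.prod_congr rfl fun i _ => ?_
        rw [← Finset.prod_mul_distrib]

/-! ### On the Siegel cone -/

/-- **On the Siegel cone, `∏_{i,j} max(1, aᵢ/aⱼ)` is at most a constant times the root product
`∏_{i<j} aᵢ/aⱼ`** (the product of the positive roots of the upper triangular Borel subgroup at
`a`; its `[K:ℚ]`-th power is the modulus `δ_B(a)` for the real scalar `a` at all archimedean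
places, Getz–Hahn (2024), (3.10); Garrett (2018), Cor. 7.3.13). If `t · a_{l+1} ≤ a_l` for all `l`
(`t > 0`), then `∏_{i,j} max(1, aᵢ/aⱼ) ≤ (max(1, t⁻¹)ⁿ)^{n²} · ∏_{i<j} aᵢ/aⱼ`: for `i < j`,
`aᵢ/aⱼ ≥ t^{j-i}` gives `max(1, aᵢ/aⱼ) ≤ max(1, t⁻¹)ⁿ · aᵢ/aⱼ`; for `i > j`,
`aᵢ/aⱼ ≤ t^{-(i-j)}` gives `max(1, aᵢ/aⱼ) ≤ max(1, t⁻¹)ⁿ` (`siegelRoot_apply_le_inv_pow_mul` of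
`ReductionTheoryGLnConjugation`). Garrett (2018), proof of Lemma 7.3.12 / Cor. 7.3.13.
[cite: Garrett2018, Lemma 7.3.12 and Cor. 7.3.13 (PDF pp. 341–342)] -/
theorem prod_max_one_div_le_mul_prod_root {t : ℝ} (ht : 0 < t) {a : Fin n → ℝ≥0ˣ}
    (hroot : ∀ i j : Fin n, (j : ℕ) = (i : ℕ) + 1 → t * ((a j : ℝ≥0) : ℝ) ≤ ((a i : ℝ≥0) : ℝ)) :
    ∏ i : Fin n, ∏ j : Fin n, max 1 (((a i : ℝ≥0) : ℝ) / ((a j : ℝ≥0) : ℝ)) ≤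
      ((max 1 t⁻¹) ^ n) ^ (n * n) *
        ∏ i : Fin n, ∏ j : Fin n,
          (if i < j then ((a i : ℝ≥0) : ℝ) / ((a j : ℝ≥0) : ℝ) else 1) := by
  set M : ℝ := (max 1 t⁻¹) ^ n with hM
  have hM1 : 1 ≤ M := one_le_pow₀ (le_max_left _ _)
  have hapos : ∀ i, 0 < ((a i : ℝ≥0) : ℝ) := fun i =>
    NNReal.coe_pos.2 (pos_iff_ne_zero.2 (a i).ne_zero)
  -- the cone inequality `a_j ≤ t⁻¹^(j-i) a_i ≤ M a_i` for `i ≤ j`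
  have hcone : ∀ i j : Fin n, i ≤ j → ((a j : ℝ≥0) : ℝ) ≤ M * ((a i : ℝ≥0) : ℝ) := by
    intro i j hij
    refine (siegelRoot_apply_le_inv_pow_mul ht hroot hij).trans ?_
    refine mul_le_mul_of_nonneg_right ?_ (hapos i).le
    calc t⁻¹ ^ ((j : ℕ) - (i : ℕ)) ≤ (max 1 t⁻¹) ^ ((j : ℕ) - (i : ℕ)) :=
          pow_le_pow_left₀ (inv_nonneg.2 ht.le) (le_max_right _ _) _
      _ ≤ (max 1 t⁻¹) ^ n := pow_le_pow_right₀ (le_max_left _ _) (by have := j.2; omega)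
  -- termwise comparison
  have hterm : ∀ i j : Fin n, max 1 (((a i : ℝ≥0) : ℝ) / ((a j : ℝ≥0) : ℝ)) ≤
      M * (if i < j then ((a i : ℝ≥0) : ℝ) / ((a j : ℝ≥0) : ℝ) else 1) := by
    intro i j
    split_ifs with hij
    · -- `i < j`: the ratio is `≥ t^(j-i) ≥ M⁻¹`
      have hq : 0 < ((a i : ℝ≥0) : ℝ) / ((a j : ℝ≥0) : ℝ) := div_pos (hapos i) (hapos j)
      refine max_le ?_ ?_
      · -- `1 ≤ M * (a i / a j)` since `a j ≤ M a i`
        rw [mul_div_assoc', le_div_iff₀ (hapos j), one_mul]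
        exact hcone i j hij.le
      · exact le_mul_of_one_le_left hq.le hM1
    · -- `j ≤ i`: the ratio is `≤ M`
      rw [mul_one]
      refine max_le hM1 ?_
      rw [div_le_iff₀ (hapos j)]
      exact hcone j i (not_lt.1 hij)
  calc ∏ i : Fin n, ∏ j : Fin n, max 1 (((a i : ℝ≥0) : ℝ) / ((a j : ℝ≥0) : ℝ))
      ≤ ∏ i : Fin n, ∏ j : Fin n,
          M * (if i < j then ((a i : ℝ≥0) : ℝ) / ((a j : ℝ≥0) : ℝ) else 1) := by
        refine Finset.prod_le_prod (fun i _ => Finset.prod_nonneg fun j _ => by positivity)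
          fun i _ => Finset.prod_le_prod (fun j _ => by positivity) fun j _ => hterm i j
    _ = M ^ (n * n) * ∏ i : Fin n, ∏ j : Fin n,
          (if i < j then ((a i : ℝ≥0) : ℝ) / ((a j : ℝ≥0) : ℝ) else 1) := by
        simp_rw [Finset.prod_mul_distrib, Finset.prod_const, Finset.card_univ, Fintype.card_fin]
        rw [← pow_mul]

/-- The same comparison after raising to a power `d` (e.g. `d = [K:ℚ]`):
`∏_{i,j} max(1, aᵢ/aⱼ)^d ≤ ((max(1, t⁻¹)ⁿ)^{n²})^d · (∏_{i<j} aᵢ/aⱼ)^d` on the Siegel cone.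
[cite: Garrett2018, Cor. 7.3.13 (PDF p. 342)] -/
theorem prod_max_one_div_pow_le_mul_prod_root_pow {t : ℝ} (ht : 0 < t) {a : Fin n → ℝ≥0ˣ}
    (hroot : ∀ i j : Fin n, (j : ℕ) = (i : ℕ) + 1 → t * ((a j : ℝ≥0) : ℝ) ≤ ((a i : ℝ≥0) : ℝ))
    (d : ℕ) :
    ∏ i : Fin n, ∏ j : Fin n, max 1 (((a i : ℝ≥0) : ℝ) / ((a j : ℝ≥0) : ℝ)) ^ d ≤
      (((max 1 t⁻¹) ^ n) ^ (n * n)) ^ d *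
        (∏ i : Fin n, ∏ j : Fin n,
          (if i < j then ((a i : ℝ≥0) : ℝ) / ((a j : ℝ≥0) : ℝ) else 1)) ^ d := by
  have h := prod_max_one_div_le_mul_prod_root ht hroot
  have h0 : 0 ≤ ∏ i : Fin n, ∏ j : Fin n, max 1 (((a i : ℝ≥0) : ℝ) / ((a j : ℝ≥0) : ℝ)) :=
    Finset.prod_nonneg fun i _ => Finset.prod_nonneg fun j _ => by positivity
  calc ∏ i : Fin n, ∏ j : Fin n, max 1 (((a i : ℝ≥0) : ℝ) / ((a j : ℝ≥0) : ℝ)) ^ d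
      = (∏ i : Fin n, ∏ j : Fin n, max 1 (((a i : ℝ≥0) : ℝ) / ((a j : ℝ≥0) : ℝ))) ^ d := by
        simp_rw [Finset.prod_pow]
    _ ≤ _ := pow_le_pow_left₀ h0 h d
    _ = _ := mul_pow _ _ _

end Matrices

end Literature.NumberTheory.Automorphic
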